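import Mathlib
import HarnessLib
import Summits.KontsevichZagierPeriods.KontsevichZagierPeriods.Theses.LinRedNormalForm
import Summits.KontsevichZagierPeriods.KontsevichZagierPeriods.Theorems.LinRedNormalFormDihedralNormalFormStubNestedReductionAux2
import Summits.KontsevichZagierPeriods.KontsevichZagierPeriods.Theorems.LinRedNormalFormDihedralNormalFormStubTorusDescentAux3

/-!
# `DihedralNormalForm`, line `torus-descent-sum-shadow`, stub `stub_nestedReduction` — Aux 6

Support file for the stub `stub_nestedReduction` (THEOREM N) of the crux `DihedralNormalForm`
(stmt-KontsevichZagierPeriods-3912, route `LinRedNormalForm`): **rule 3 along an ARBITRARY axis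
of the open cube** (`Nested.nl_axis_ocube`).  The last-coordinate version `Nested.nl_last_ocube`
(Aux 2) is conjugated by the coordinate relabelling `reix p` (`p ↦ last`,
`p.succAbove j ↦ castSucc j`, from the torus-descent tools) read as a change-of-variables move
(`KZ.IntegralRep.reindex`, `KZ.of_sub_of_reindex_mem_relations`); the fibres become
`t ↦ Fin.insertNth p t y` and the closed band becomes the axis band `Nested.aband p`.

References: M. Kontsevich, D. Zagier, *Periods* (2001), §1.2, rules (2), (3).
-/

noncomputable section

open MeasureTheory Set

namespace Summit.KontsevichZagierPeriods.DihedralNormalForm.TorusDescent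

open Literature.NumberTheory.Transcendental
open Literature.ModelTheory.ExponentialFields (IsSemialgebraic)

namespace Nested

variable {k : ℕ}

/-- Semialgebraic functions stay semialgebraic after relabelling the coordinates. -/
theorem isSemialgebraicFunOn_comp_perm (σ : Fin k ≃ Fin k) {S : Set (Fin k → ℝ)}
    {f : (Fin k → ℝ) → ℝ} (hf : IsSemialgebraicFunOn ℚ S f) :
    IsSemialgebraicFunOn ℚ {w | (fun i => w (σ i)) ∈ S} (fun w => f (fun i => w (σ i))) := by
  -- adapted from `KZ.IntegralRep.reindex`
  rw [isSemialgebraicFunOn_iff]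
  let ρ : Fin (k + 1) → Fin (k + 1) := Fin.lastCases (Fin.last k) fun i => Fin.castSucc (σ i)
  have hΓ := (isSemialgebraicFunOn_iff.mp hf).preimage_comp ρ
  convert hΓ using 1
  have hinit : ∀ w : Fin (k + 1) → ℝ, Fin.init (w ∘ ρ) = fun i => Fin.init w (σ i) := by
    intro w; ext i; simp [Fin.init, ρ]
  have hlast : ∀ w : Fin (k + 1) → ℝ, (w ∘ ρ) (Fin.last k) = w (Fin.last k) := by
    intro w; simp [ρ]
  ext w
  simp only [mem_setOf_eq, mem_preimage, hinit, hlast]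

/-- The axis band: all coordinates but `p` in `(0,1)`, the axis coordinate in `[0,1]`. -/
def aband (p : Fin (k + 1)) : Set (Fin (k + 1) → ℝ) :=
  {z | (∀ l : Fin k, z (p.succAbove l) ∈ Ioo (0:ℝ) 1) ∧ z p ∈ Icc (0:ℝ) 1}

/-- Reading through `reix p` turns the closed band into the axis band. -/
theorem comp_reix_mem_aband_iff (p : Fin (k + 1)) (w : Fin (k + 1) → ℝ) :
    (fun i => w (reix p i)) ∈ aband p ↔ w ∈ cband k := by
  rw [comp_reix_eq_insertNth, mem_cband, aband, mem_setOf_eq]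
  simp only [Fin.insertNth_apply_succAbove, Fin.insertNth_apply_same, mem_Icc]
  rfl

/-- Reading through `reix p` preserves the open cube. -/
theorem comp_reix_mem_ocube_iff (p : Fin (k + 1)) (w : Fin (k + 1) → ℝ) :
    (fun i => w (reix p i)) ∈ ocube (k + 1) ↔ w ∈ ocube (k + 1) := by
  constructor
  · intro h i
    simpa using h ((reix p).symm i)
  · intro h i
    exact h _

/-- `Fin.snoc y t` read through `reix p` is `Fin.insertNth p t y`. -/
theorem snoc_comp_reix (p : Fin (k + 1)) (y : Fin k → ℝ) (t : ℝ) :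
    (fun i => (Fin.snoc y t : Fin (k + 1) → ℝ) (reix p i)) = Fin.insertNth p t y := by
  rw [comp_reix_eq_insertNth]
  simp

/-- The axis band is the preimage of the closed band: it is `ℚ`-semialgebraic. -/
theorem isSemialgebraic_aband (p : Fin (k + 1)) : IsSemialgebraic ℚ (aband (k := k) p) := by
  have h := (isSemialgebraic_cband k).preimage_comp (reix p).symm
  convert h using 1
  ext z
  rw [mem_preimage, ← comp_reix_mem_aband_iff p]
  simp [Function.comp]

/-- **Rule 3 along the axis `p` of the open cube.**  If `R = [(0,1)ᵏ⁺¹, W]` and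
`rb = [(0,1)ᵏ, F(insertNth p 1 ·) − F(insertNth p 0 ·)]` are representations, `F`, `W` are
`ℚ`-semialgebraic on the axis band, and on every fibre `t ↦ F (insertNth p t y)` over the open
cube is continuous on `[0,1]` with derivative `W (insertNth p t y)` on `(0,1)`, then
`[R] − [rb] ∈ KZ.relations` (relabel `p ↦ last`, then `nl_last_ocube`). -/
theorem nl_axis_ocube (p : Fin (k + 1)) (R : KZ.IntegralRep (k + 1)) (rb : KZ.IntegralRep k)
    (F W : (Fin (k + 1) → ℝ) → ℝ) (hRdom : R.domain = ocube (k + 1))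
    (hRW : EqOn R.integrand W R.domain) (hbdom : rb.domain = ocube k)
    (hW : IsSemialgebraicFunOn ℚ (aband p) W) (hF : IsSemialgebraicFunOn ℚ (aband p) F)
    (hcont : ∀ y ∈ ocube k, ContinuousOn (fun t : ℝ => F (Fin.insertNth p t y)) (Icc 0 1))
    (hder : ∀ y ∈ ocube k, ∀ t ∈ Ioo (0 : ℝ) 1,
      HasDerivAt (fun s : ℝ => F (Fin.insertNth p s y)) (W (Fin.insertNth p t y)) t)
    (hbase : ∀ y ∈ ocube k, rb.integrand y = F (Fin.insertNth p 1 y) - F (Fin.insertNth p 0 y)) :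
    KZ.of R - KZ.of rb ∈ KZ.relations := by
  -- relabel the coordinates of `R`
  set R' := R.reindex (reix p) with hR'
  have h1 : KZ.of R - KZ.of R' ∈ KZ.relations := KZ.of_sub_of_reindex_mem_relations R (reix p)
  have hband : ∀ {G : (Fin (k + 1) → ℝ) → ℝ}, IsSemialgebraicFunOn ℚ (aband p) G →
      IsSemialgebraicFunOn ℚ (cband k) (fun w => G (fun i => w (reix p i))) := by
    intro G hG
    have h := isSemialgebraicFunOn_comp_perm (reix p) hG
    convert h using 1
    ext w
    exact (comp_reix_mem_aband_iff p w).symm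
  have h2 : KZ.of R' - KZ.of rb ∈ KZ.relations := by
    refine nl_last_ocube R' rb (fun w => F (fun i => w (reix p i))) (fun w => W (fun i => w (reix p i)))
      ?_ ?_ hbdom (hband hW) (hband hF) ?_ ?_ ?_
    · ext w
      rw [hR', KZ.IntegralRep.reindex_domain, mem_setOf_eq, hRdom]
      exact comp_reix_mem_ocube_iff p w
    · intro w hw
      rw [hR', KZ.IntegralRep.reindex_domain, mem_setOf_eq] at hw
      exact hRW hw
    · intro y hy
      simpa only [snoc_comp_reix] using hcont y hy
    · intro y hy t ht
      simpa only [snoc_comp_reix] using hder y hy t ht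
    · intro y hy
      simpa only [snoc_comp_reix] using hbase y hy
  have := add_mem h1 h2
  rwa [sub_add_sub_cancel] at this

end Nested

/-- **Registered sub-goal `stub_nestedReductionAux6`**: rule 3 (Newton–Leibniz) along an arbitrary axis of the open cube (`Nested.nl_axis_ocube`). -/
theorem stub_nestedReductionAux6 : ∀ (k : ℕ) (p : Fin (k + 1)) (R : Literature.NumberTheory.Transcendental.KZ.IntegralRep (k + 1)) (rb : Literature.NumberTheory.Transcendental.KZ.IntegralRep k) (F W : (Fin (k + 1) → ℝ) → ℝ), R.domain = {x : Fin (k + 1) → ℝ | ∀ i, x i ∈ Set.Ioo (0:ℝ) 1} → Set.EqOn R.integrand W R.domain → rb.domain = {x : Fin k → ℝ | ∀ i, x i ∈ Set.Ioo (0:ℝ) 1} → Literature.NumberTheory.Transcendental.IsSemialgebraicFunOn ℚ {z : Fin (k + 1) → ℝ | (∀ l : Fin k, z (p.succAbove l) ∈ Set.Ioo (0:ℝ) 1) ∧ z p ∈ Set.Icc (0:ℝ) 1} W → Literature.NumberTheory.Transcendental.IsSemialgebraicFunOn ℚ {z : Fin (k + 1) → ℝ | (∀ l : Fin k, z (p.succAbove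 l) ∈ Set.Ioo (0:ℝ) 1) ∧ z p ∈ Set.Icc (0:ℝ) 1} F → (∀ y ∈ {x : Fin k → ℝ | ∀ i, x i ∈ Set.Ioo (0:ℝ) 1}, ContinuousOn (fun t : ℝ => F (Fin.insertNth p t y)) (Set.Icc 0 1)) → (∀ y ∈ {x : Fin k → ℝ | ∀ i, x i ∈ Set.Ioo (0:ℝ) 1}, ∀ t ∈ Set.Ioo (0:ℝ) 1, HasDerivAt (fun s : ℝ => F (Fin.insertNth p s y)) (W (Fin.insertNth p t y)) t) → (∀ y ∈ {x : Fin k → ℝ | ∀ i, x i ∈ Set.Ioo (0:ℝ) 1}, rb.integrand y = F (Fin.insertNth p 1 y) - F (Fin.insertNth p 0 y)) → Literature.NumberTheory.Transcendental.KZ.of R - Literature.NumberTheory.Transcendental.KZ.of rb ∈ Literature.NumberTheory.Transcendental.KZ.relations :=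
  fun _ p R rb F W h1 h2 h3 hW hF hc hd hb =>
    Nested.nl_axis_ocube p R rb F W h1 h2 h3 hW hF hc hd hb

end Summit.KontsevichZagierPeriods.DihedralNormalForm.TorusDescent
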